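import Summits.AtomisticToContinuum.Crystallization.Theorems.RepetitiveNetworkReductionEvaporationRecurrence
import Summits.AtomisticToContinuum.Crystallization.Theorems.RepetitiveNetworkReductionEvaporationWindows

/-!
# `NetworkRecurrenceTransfer.stub_evaporationLaw` — part 3/3: the evaporation law, and the stub BY NAME AND TEXT

Registered stub `stub_evaporationLaw` of `NetworkRecurrenceTransfer` (RED, `stmt-AtomisticToContinuum-27236`, route
`RepetitiveNetworkReduction`, sub-problem `Crystallization` of `AtomisticToContinuum`; skeleton of record sha256
`1c2fef87a5641791…`, stub text 5938 chars, byte-identical below), written by the decomp-a2c cell's lens-2 g18 seat.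

`evaporationLaw_core`: a rooted `δ`-separated point set `S` in the good class (textured `ApprS`, Nash `NashS`,
`IsMuGSC lennardJones eStar S`) which is uniformly recurrent (`URS S`) EVAPORATES to a point-stationary law: the
Benjamini–Schramm limit `P` of its uniformly rooted Følner windows (part 2, `exists_windows`, fed to
`FrustratedLawDichotomyLocalLimitEngine.exists_windowLimit`) is a probability law of rooted `δ`-hard-core configurations,
point-stationary, with mean root energy `≤ e⋆` (emptying windows costs `≤ e⋆` per particle up to boundary terms), and
`P`-a.e. configuration is a rooted local limit of re-rootings `S − c k` (`c k ∈ S` deep window points), hence in the good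
class (`RepetitiveNetworkReductionRecurrentMember.goodClass_closed`) and uniformly recurrent (part 1, `urs_of_limit`).
`stub_evaporationLaw` is the counting-measure dictionary wrapper (`apprM_iff`, `nashM_iff`, `muGM_iff`). All `[folklore]`.
No new definitions.
-/

open scoped BigOperators Topology
open Filter Set Metric MeasureTheory

namespace Summit.AtomisticToContinuum.Crystallization.Theorems.RepetitiveNetworkReductionEvaporationLaw

open Literature.MathematicalPhysics.StatisticalMechanics
open Literature.Probability.Process (IsRootedHardCore IsPointStationaryLaw LocallyMatches atoms atoms_count_restrict
  count_restrict_singleton_ne_zero_iff)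
open Summit.AtomisticToContinuum.Crystallization.Theorems.RepetitiveNetworkReductionRecurrentMember

/-! ## The evaporation law of one uniformly recurrent good configuration -/

/-- **Evaporation law (set level).** A uniformly recurrent member `S` of `goodClass δ R₇ R₈ R₉` is carried by a
point-stationary law of rooted `δ`-hard-core configurations which are a.s. uniformly recurrent members of the class, with
mean root energy `≤ e⋆`. [folklore] -/
theorem evaporationLaw_core {δ R₇ R₈ R₉ : ℝ} (hδ : 0 < δ) {S : Set (EuclideanSpace ℝ (Fin 3))}
    (hS : S ∈ goodClass δ R₇ R₈ R₉) (hU : URS S) :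
    ∃ P : Measure (Measure (EuclideanSpace ℝ (Fin 3))), IsProbabilityMeasure P ∧
      (∀ᵐ ν ∂P, IsRootedHardCore δ ν) ∧ IsPointStationaryLaw P ∧
      (∀ᵐ ν ∂P, ∃ Z ∈ goodClass δ R₇ R₈ R₉, URS Z ∧
        ν = (Measure.count : Measure (EuclideanSpace ℝ (Fin 3))).restrict Z) ∧
      (∫ ν, rootEnergy lennardJones ν ∂P) ≤ eStar := by
  obtain ⟨h0, hsep, hA, hN, hM⟩ := hS
  obtain ⟨n, w, r, t, hn, hwsep, hwS, hwin, -, ht0, ht, hthin, henergy⟩ := exists_windows hδ h0 hsep hM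
  obtain ⟨P, hP, hcore, hstat, hen, hsupp⟩ :=
    FrustratedLawDichotomyLocalLimitEngine.exists_windowLimit hδ n hn w hwsep (fun _ => 0) r t ht0 ht hthin
  refine ⟨P, hP, hcore, hstat, ?_, le_of_forall_gt_imp_ge_of_dense fun c hc => hen c (henergy c hc)⟩
  filter_upwards [hcore, hsupp] with ν hν hsu
  obtain ⟨Z, h0Z, hZsep, rfl⟩ := hν
  rw [atoms_count_restrict] at hsu
  -- deep re-rooting points `c k`, matched at depth `k` to tolerance `1/(k+1)`
  have hk : ∀ k : ℕ, ∃ (m : ℕ) (a : Fin (n m)), dist (w m a) 0 + k ≤ r m ∧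
      LocallyMatches (k : ℝ) (1 / ((k : ℝ) + 1)) Z (Set.range fun b => w m b - w m a) := fun k => by
    obtain ⟨m, -, a, h1, h2⟩ := hsu k 0 (1 / ((k : ℝ) + 1)) (by positivity)
    exact ⟨m, a, h1, h2⟩
  choose mk ak hdeep hLM using hk
  have hcS : ∀ k, w (mk k) (ak k) ∈ S := fun k => hwS _ _
  have hconv : ∀ R ε : ℝ, 0 < ε → ∀ᶠ k in atTop,
      BallMatch ε R 0 ((fun p => p - w (mk k) (ak k)) '' S) Z := by
    intro R ε hε
    have h1 : ∀ᶠ k : ℕ in atTop, R ≤ (k : ℝ) := tendsto_natCast_atTop_atTop.eventually_ge_atTop R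
    have h2 : ∀ᶠ k : ℕ in atTop, 1 / ((k : ℝ) + 1) < ε :=
      (tendsto_order.1 (tendsto_one_div_add_atTop_nhds_zero_nat : Tendsto (fun k : ℕ => 1 / ((k : ℝ) + 1))
        atTop (𝓝 0))).2 ε hε
    filter_upwards [h1, h2] with k hk1 hk2
    have hL := hLM k
    constructor
    · intro s hs hsR
      obtain ⟨p, ⟨b, rfl⟩, hp⟩ := hL.2 s hs (by rw [← dist_zero_right]; exact hsR.trans hk1)
      exact ⟨w (mk k) b - w (mk k) (ak k), ⟨w (mk k) b, hwS _ _, rfl⟩, by rw [dist_comm]; exact hp.trans hk2.le⟩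
    · rintro _ ⟨s', hs', rfl⟩ hqR
      have hqR' : ‖s' - w (mk k) (ak k)‖ ≤ R := by rwa [← dist_zero_right]
      have hs'r : dist s' 0 ≤ r (mk k) := by
        have hd := hdeep k
        rw [dist_zero_right] at hd ⊢
        calc ‖s'‖ = ‖(s' - w (mk k) (ak k)) + w (mk k) (ak k)‖ := by congr 1; abel
          _ ≤ ‖s' - w (mk k) (ak k)‖ + ‖w (mk k) (ak k)‖ := norm_add_le _ _
          _ ≤ r (mk k) := by linarith
      obtain ⟨b, hb⟩ := hwin (mk k) s' hs' hs'r
      obtain ⟨q, hq, hd⟩ := hL.1 (s' - w (mk k) (ak k)) ⟨b, by beta_reduce; rw [hb]⟩ (hqR'.trans hk1)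
      exact ⟨q, hq, by rw [dist_comm]; exact hd.trans hk2.le⟩
  have hZ : Z ∈ goodClass δ R₇ R₈ R₉ :=
    goodClass_closed hδ (fun k => (fun p => p - w (mk k) (ak k)) '' S)
      (fun k => goodClass_image_sub hδ ⟨h0, hsep, hA, hN, hM⟩ (hcS k)) Z h0Z hZsep hconv
  exact ⟨Z, hZ, urs_of_limit hδ hsep hU (fun k => w (mk k) (ak k)) hcS hconv, rfl⟩

/-! ## The stub, by name and text -/

/-- **`stub_evaporationLaw`** (registered stub of `NetworkRecurrenceTransfer`, by name and text): a rooted `δ`-hard-core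
counting measure on `ℝ³` which is textured, Nash, an `e⋆`-μGSC of `V_LJ` and uniformly recurrent is carried by a
point-stationary law of such configurations with mean root energy `≤ e⋆` (Benjamini–Schramm evaporation of one
configuration: uniform rooting over Følner windows + local compactness). -/
theorem stub_evaporationLaw : ∀ δ : ℝ, 0 < δ → ∀ R₇ R₈ R₉ : ℝ, ∀ μ : MeasureTheory.Measure (EuclideanSpace ℝ (Fin 3)), let Gy : ℝ → (N : ℕ) → (Fin N → EuclideanSpace ℝ (Fin 3)) → Fin N → Prop := fun η N y j => let d : ℝ := sInf ((fun z => dist z (y (j : Fin N))) '' (Set.range (y) \ {(y (j : Fin N))})); let T : Set (EuclideanSpace ℝ (Fin 3)) := {z : EuclideanSpace ℝ (Fin 3) | z ∈ Set.range (y) ∧ z ≠ (y (j : Fin N)) ∧ dist z (y (j : Fin N)) < 13 / 10 * d}; ∃ A : EuclideanSpace ℝ (Fin 3) →ₗᵢ[ℝ] EuclideanSpace ℝ (Fin 3), (∃ e : ↥T ≃ ↥Literature.Geometry.DiscreteGeometry.fccKissingPattern, ∀ t : ↥T, dist (d⁻¹ • ((t : EuclideanSpace ℝ (Fin 3)) -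 (y (j : Fin N)))) (A ((e t : ↥Literature.Geometry.DiscreteGeometry.fccKissingPattern) : EuclideanSpace ℝ (Fin 3))) ≤ η) ∨ (∃ e : ↥T ≃ ↥Literature.Geometry.DiscreteGeometry.hcpKissingPattern, ∀ t : ↥T, dist (d⁻¹ • ((t : EuclideanSpace ℝ (Fin 3)) - (y (j : Fin N)))) (A ((e t : ↥Literature.Geometry.DiscreteGeometry.hcpKissingPattern) : EuclideanSpace ℝ (Fin 3))) ≤ η); let TexBall : (N : ℕ) → (Fin N → EuclideanSpace ℝ (Fin 3)) → Fin N → ℝ → ℝ → ℝ → ℝ → Prop := fun N y i R R₇ R₈ R₉ => (∀ a b : Fin N, a ≠ b → (7 : ℝ) / 10 ≤ dist (y a) (y b)) ∧ (∀ j : Fin N, dist (y j) (y i) ≤ R → ¬ Gy (1 / 20) N (y) j) ∧ (∀ j : Fin N, dist (y j) (y i) ≤ R → ¬ ((∀ j' : Fin N, dist (y j') (y j) ≤ R₇ → ¬ Gy (1 / 20) N (y) j') ∧ (∀ z : EuclideanSpace ℝ (Fin 3), dist z (y j) ≤ R₇ → ∃ k : Fin N, dist z (y k) ≤ 1) ∧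 (∀ j' : Fin N, dist (y j') (y j) ≤ R₇ → (let d : ℝ := sInf ((fun z => dist z (y j')) '' (Set.range (y) \ {(y j')})); ∀ k : Fin N, y k ≠ y j' → dist (y k) (y j') < 27 / 20 * d → 5 ≤ Nat.card {m : Fin N // y m ≠ y j' ∧ dist (y m) (y j') < 27 / 20 * d ∧ y m ≠ y k ∧ dist (y m) (y k) < 27 / 20 * d})))) ∧ (∀ j : Fin N, dist (y j) (y i) ≤ R → ∃ k : Fin N, dist (y k) (y j) ≤ R₈ ∧ Gy (1 / 8) N (y) k) ∧ (∀ j : Fin N, dist (y j) (y i) ≤ R → ¬ ((∀ j' : Fin N, dist (y j') (y j) ≤ R₉ → ¬ Gy (1 / 20) N (y) j') ∧ (Nat.card {j' : Fin N // dist (y j') (y j) ≤ R₉ ∧ ¬ Gy (1 / 8) N (y) j'} : ℝ) ≤ 1 / 2 * (Nat.card {j' : Fin N // dist (y j') (y j) ≤ R₉} : ℝ) ∧ (∀ j' : Fin N, dist (y j') (y j) ≤ R₉ → ¬ Gy (1 / 8) N (y) j' → ¬ (let d : ℝ := sInf ((fun z => dist z (y j')) '' (Set.range (y) \ {(y j')}));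 ∀ k : Fin N, y k ≠ y j' → dist (y k) (y j') < 27 / 20 * d → 5 ≤ Nat.card {m : Fin N // y m ≠ y j' ∧ dist (y m) (y j') < 27 / 20 * d ∧ y m ≠ y k ∧ dist (y m) (y k) < 27 / 20 * d})))); let Appr : MeasureTheory.Measure (EuclideanSpace ℝ (Fin 3)) → ℝ → ℝ → ℝ → Prop := fun μ R₇ R₈ R₉ => ∀ q : EuclideanSpace ℝ (Fin 3), μ {q} ≠ 0 → ∀ R ε : ℝ, 0 < ε → ∃ (N : ℕ) (y : Fin N → EuclideanSpace ℝ (Fin 3)) (i : Fin N), TexBall N y i R R₇ R₈ R₉ ∧ (∀ p : EuclideanSpace ℝ (Fin 3), μ {p} ≠ 0 → dist p q ≤ R → ∃ k : Fin N, dist (y k - y i) (p - q) ≤ ε) ∧ (∀ k : Fin N, dist (y k) (y i) ≤ R → ∃ p : EuclideanSpace ℝ (Fin 3), μ {p} ≠ 0 ∧ dist (y k - y i) (p - q) ≤ ε); let AtomS : MeasureTheory.Measure (EuclideanSpace ℝ (Fin 3)) → Set (EuclideanSpace ℝ (Fin 3)) := fun μ => {p : EuclideanSpace ℝ (Fin 3)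 | μ {p} ≠ 0}; let NashM : MeasureTheory.Measure (EuclideanSpace ℝ (Fin 3)) → Prop := fun μ => ∀ p : EuclideanSpace ℝ (Fin 3), μ {p} ≠ 0 → ∀ y : EuclideanSpace ℝ (Fin 3), (∀ q : EuclideanSpace ℝ (Fin 3), μ {q} ≠ 0 → q ≠ p → y ≠ q) → ∑' q : {q : EuclideanSpace ℝ (Fin 3) // μ {q} ≠ 0 ∧ q ≠ p}, Literature.MathematicalPhysics.StatisticalMechanics.lennardJones (dist p (q : EuclideanSpace ℝ (Fin 3))) ≤ ∑' q : {q : EuclideanSpace ℝ (Fin 3) // μ {q} ≠ 0 ∧ q ≠ p}, Literature.MathematicalPhysics.StatisticalMechanics.lennardJones (dist y (q : EuclideanSpace ℝ (Fin 3))); let MuG : MeasureTheory.Measure (EuclideanSpace ℝ (Fin 3)) → Prop := fun μ => ((∀ r : EuclideanSpace ℝ (Fin 3), Summable fun y : ↥((AtomS μ)) => Literature.MathematicalPhysics.StatisticalMechanics.lennardJones (dist r y)) ∧ ∀ (n : ℕ) (xf : Fin n → EuclideanSpace ℝ (Fin 3)), Function.Injective xf → Set.range xf ⊆ (AtomS μ)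 → ∀ (k : ℕ) (R : Fin k → EuclideanSpace ℝ (Fin 3)), Function.Injective R → Disjoint (Set.range R) ((AtomS μ) \ Set.range xf) → Literature.MathematicalPhysics.StatisticalMechanics.interactionEnergy Literature.MathematicalPhysics.StatisticalMechanics.lennardJones xf + (∑ i, ∑' y : ↥((AtomS μ) \ Set.range xf), Literature.MathematicalPhysics.StatisticalMechanics.lennardJones (dist (xf i) y)) - (⨅ Q : Literature.MathematicalPhysics.StatisticalMechanics.PeriodicConfiguration 3, Q.energyPerParticle Literature.MathematicalPhysics.StatisticalMechanics.lennardJones) * n ≤ Literature.MathematicalPhysics.StatisticalMechanics.interactionEnergy Literature.MathematicalPhysics.StatisticalMechanics.lennardJones R + (∑ i, ∑' y : ↥((AtomS μ) \ Set.range xf), Literature.MathematicalPhysics.StatisticalMechanics.lennardJones (dist (R i) y)) - (⨅ Q : Literature.MathematicalPhysics.StatisticalMechanics.PeriodicConfiguration 3, Q.energyPerParticle Literature.MathematicalPhysics.StatisticalMechanics.lennardJones) * k); let UR : Set (EuclideanSpace ℝ (Fin 3)) → Prop := fun S => ∀ R ε : ℝ, 0 < ε → ∃ G : ℝ, ∀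 w ∈ S, ∃ g ∈ S, dist g w ≤ G ∧ (∀ s ∈ S, dist s (0 : EuclideanSpace ℝ (Fin 3)) ≤ R → ∃ a ∈ S, dist (a - g) s ≤ ε) ∧ (∀ a ∈ S, dist (a - g) (0 : EuclideanSpace ℝ (Fin 3)) ≤ R → ∃ s ∈ S, dist (a - g) s ≤ ε); Literature.Probability.Process.IsRootedHardCore δ μ → Appr μ R₇ R₈ R₉ → NashM μ → MuG μ → UR (AtomS μ) → ∃ P : MeasureTheory.Measure (MeasureTheory.Measure (EuclideanSpace ℝ (Fin 3))), MeasureTheory.IsProbabilityMeasure P ∧ (∀ᵐ ν ∂P, Literature.Probability.Process.IsRootedHardCore δ ν) ∧ Literature.Probability.Process.IsPointStationaryLaw P ∧ (∀ᵐ ν ∂P, Appr ν R₇ R₈ R₉) ∧ (∀ᵐ ν ∂P, NashM ν) ∧ (∀ᵐ ν ∂P, MuG ν) ∧ (∀ᵐ ν ∂P, UR (AtomS ν)) ∧ (∫ ν, Literature.MathematicalPhysics.StatisticalMechanics.rootEnergy Literature.MathematicalPhysics.StatisticalMechanics.lennardJones ν ∂P) ≤ (⨅ Q : Literature.MathematicalPhysics.StatisticalMechanics.PeriodicConfiguration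 3, Q.energyPerParticle Literature.MathematicalPhysics.StatisticalMechanics.lennardJones) := by
  intro δ hδ R₇ R₈ R₉ μ
  dsimp only
  intro hHC hA hN hM hU
  obtain ⟨S, h0S, hSsep, rfl⟩ := hHC
  have hA' : ApprM ((Measure.count : Measure (EuclideanSpace ℝ (Fin 3))).restrict S) R₇ R₈ R₉ := hA
  have hN' : NashM ((Measure.count : Measure (EuclideanSpace ℝ (Fin 3))).restrict S) := hN
  have hM' : MuGM ((Measure.count : Measure (EuclideanSpace ℝ (Fin 3))).restrict S) := hM
  have hSa : {p : EuclideanSpace ℝ (Fin 3) | (Measure.count : Measure (EuclideanSpace ℝ (Fin 3))).restrict S {p} ≠ 0} = S :=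
    Set.ext fun p => count_restrict_singleton_ne_zero_iff S p
  have hU' : URS S := by
    have hU2 : URS {p : EuclideanSpace ℝ (Fin 3) |
        (Measure.count : Measure (EuclideanSpace ℝ (Fin 3))).restrict S {p} ≠ 0} := hU
    rwa [hSa] at hU2
  have hS : S ∈ goodClass δ R₇ R₈ R₉ :=
    ⟨h0S, hSsep, (apprM_iff S R₇ R₈ R₉).1 hA', (nashM_iff S).1 hN', (muGM_iff S).1 hM'⟩
  obtain ⟨P, hP, hcore, hstat, hclass, hen⟩ := evaporationLaw_core hδ hS hU'
  refine ⟨P, hP, hcore, hstat, ?_, ?_, ?_, ?_, hen⟩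
  · filter_upwards [hclass] with ν hν
    obtain ⟨Z, hZ, -, rfl⟩ := hν
    exact (apprM_iff Z R₇ R₈ R₉).2 hZ.2.2.1
  · filter_upwards [hclass] with ν hν
    obtain ⟨Z, hZ, -, rfl⟩ := hν
    exact (nashM_iff Z).2 hZ.2.2.2.1
  · filter_upwards [hclass] with ν hν
    obtain ⟨Z, hZ, -, rfl⟩ := hν
    exact (muGM_iff Z).2 hZ.2.2.2.2
  · filter_upwards [hclass] with ν hν
    obtain ⟨Z, hZ, hUZ, rfl⟩ := hν
    have hZa : {p : EuclideanSpace ℝ (Fin 3) |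
        (Measure.count : Measure (EuclideanSpace ℝ (Fin 3))).restrict Z {p} ≠ 0} = Z :=
      Set.ext fun p => count_restrict_singleton_ne_zero_iff Z p
    have hUZ' : URS {p : EuclideanSpace ℝ (Fin 3) |
        (Measure.count : Measure (EuclideanSpace ℝ (Fin 3))).restrict Z {p} ≠ 0} := by
      rw [hZa]; exact hUZ
    exact hUZ'

end Summit.AtomisticToContinuum.Crystallization.Theorems.RepetitiveNetworkReductionEvaporationLaw
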